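import Summits.Ventures.PercRepro.C025ProfileGirthPred

/-!
# THE ROWS `(q, u)` AT GIRTH `≥ u − 1` — PART C: THE DOUBLE COUNT WITH `m_S ≥ 2` AS A HYPOTHESIS (night-3 g19)

Part B proved the Hall form `(H⁺_{q, v+2})` at girth `≥ v + 1` (`q + 1 ≤ v`) for every rank `≠ v + 2`; at rank `v + 2`
the double count of part A needs two points outside the closure of every `(v+2)`-set of rank `v + 1` — which part A
got from `ρ(E) ≥ v + 3`.  Here that consequence is the hypothesis `hout` (parts A–B word for word):
`card_le_card_of_girth_pred_family_out`, `card_upAt_le_card_shadowLevel_pred_out`, **`hallIneq_of_girth_pred_out`**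
`(hg) (hrank : v + 2 ≤ ρ(E)) (hout) (hqv : q + 1 ≤ v) : Profile.HallIneq M q (v + 2)`; and the small tools of part D:
`rkN_le_rkN_erase_add_one`, `two_le_card_out_of_no_coloop` (at rank `v + 2` without coloops `hout` holds: a hyperplane
missing one point makes that point a coloop), `exists_mem_notMem_closure_of_rkN_lt`, `choose_le_choose_of_le_of_add_le`
(`C(n, q) ≤ C(n, k)` for `q ≤ k`, `k + q ≤ n`).
No `def`, no `instance`, no notation.  Axioms: standard.
-/

open scoped Matroid

namespace PercRepro

open Set Finset ThmH Staged

namespace GirthRows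

variable {α : Type} [DecidableEq α] {M : Matroid α} [M.Finite]

open scoped Classical

/-- **The double count for a family, with the two points outside the closure as a hypothesis**: part A's
`card_le_card_of_girth_pred_family` used `ρ(E) ≥ v + 3` for (i) two points outside the closure of every `(v+2)`-set of
rank `v + 1` and (ii) the two extension points of a rank-`v` set; here (i) is the hypothesis `hout` and (ii) needs only
`ρ(E) ≥ v + 2`.  The proof is part A's word for word. -/
theorem card_le_card_of_girth_pred_family_out {v : ℕ} (hg : ∀ T ⊆ M.E, T.encard ≤ v → M.Indep T)
    (hrank : ((v + 2 : ℕ) : ℕ∞) ≤ M.eRank)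
    (hout : ∀ S ⊆ gr M, S.card = v + 2 → rkN M S = v + 1 →
      2 ≤ ((gr M).filter (fun x => x ∉ M.closure (S : Set α))).card)
    {P L : Finset (Finset α)}
    (hP : P ⊆ Finset.powersetCard (v + 2) (gr M))
    (hL1 : ∀ S ∈ P, M.Indep (S : Set α) → S ∈ L)
    (hL2 : ∀ S ∈ P, rkN M S = v + 1 → ∀ y ∈ gr M, y ∉ M.closure (S : Set α) → insert y S ∈ L)
    (hL3 : ∀ S ∈ P, rkN M S = v → ∀ y ∈ gr M, y ∉ M.closure (S : Set α) →
      ∀ y' ∈ gr M, y' ∉ M.closure ((insert y S : Finset α) : Set α) → insert y' (insert y S) ∈ L) :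
    P.card ≤ L.card := by
  classical
  have hPmem : ∀ S ∈ P, S ⊆ gr M ∧ S.card = v + 2 := fun S hS => Finset.mem_powersetCard.1 (hP hS)
  -- the three classes of members
  set I := P.filter (fun S : Finset α => M.Indep (S : Set α)) with hI
  set D₁ := P.filter (fun S : Finset α => rkN M S = v + 1) with hD₁
  set D₂ := P.filter (fun S : Finset α => rkN M S = v) with hD₂
  -- the three classes of targets (subsets of the ground set of the right size and rank)
  set T₁ := L.filter (fun T : Finset α => T ⊆ gr M ∧ T.card = v + 3 ∧ rkN M T = v + 2) with hT₁
  set T₂ := L.filter (fun T : Finset α => T ⊆ gr M ∧ T.card = v + 4 ∧ rkN M T = v + 2) with hT₂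
  -- a member is independent, or of rank `v + 1`, or of rank `v`
  have hclass : ∀ S ∈ P, M.Indep (S : Set α) ∨ rkN M S = v + 1 ∨ rkN M S = v := by
    intro S hS
    obtain ⟨hSg, hSc⟩ := hPmem S hS
    by_cases hi : M.Indep (S : Set α)
    · exact Or.inl hi
    · right
      have hlt : rkN M S < S.card := ThinGirth.rkN_lt_card_of_not_indep hi
      have hge : v ≤ rkN M S := le_rkN_of_girth hg hSg (by omega)
      omega
  have hIrk : ∀ S ∈ I, rkN M S = v + 2 := by
    intro S hS
    rw [hI, Finset.mem_filter] at hS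
    rw [Staged.rkN_eq_iff, hS.2.eRk_eq_encard, Set.encard_coe_eq_coe_finsetCard, (hPmem S hS.1).2]
  have hcover : P.card = I.card + D₁.card + D₂.card := by
    have hdisj1 : Disjoint I D₁ := by
      rw [Finset.disjoint_left]
      intro S hSI hSD
      have h1 := hIrk S hSI
      rw [hD₁, Finset.mem_filter] at hSD
      omega
    have hdisj2 : Disjoint (I ∪ D₁) D₂ := by
      rw [Finset.disjoint_left]
      intro S hSU hSD
      rw [hD₂, Finset.mem_filter] at hSD
      rcases Finset.mem_union.1 hSU with hSI | hSD₁
      · have := hIrk S hSI; omega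
      · rw [hD₁, Finset.mem_filter] at hSD₁; omega
    have hP' : P = I ∪ D₁ ∪ D₂ := by
      ext S
      constructor
      · intro hS
        rcases hclass S hS with h | h | h
        · exact Finset.mem_union.2 (Or.inl (Finset.mem_union.2 (Or.inl (Finset.mem_filter.2 ⟨hS, h⟩))))
        · exact Finset.mem_union.2 (Or.inl (Finset.mem_union.2 (Or.inr (Finset.mem_filter.2 ⟨hS, h⟩))))
        · exact Finset.mem_union.2 (Or.inr (Finset.mem_filter.2 ⟨hS, h⟩))
      · intro hS
        rcases Finset.mem_union.1 hS with h | h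
        · rcases Finset.mem_union.1 h with h' | h'
          · exact (Finset.mem_filter.1 h').1
          · exact (Finset.mem_filter.1 h').1
        · exact (Finset.mem_filter.1 h).1
    rw [hP', Finset.card_union_of_disjoint hdisj2, Finset.card_union_of_disjoint hdisj1]
  have hnotMem : ∀ S : Finset α, S ⊆ gr M → ∀ y, y ∉ M.closure (S : Set α) → y ∉ S := by
    intro S hSg y hy h
    exact hy (M.subset_closure (S : Set α) (by rw [← coe_gr]; exact_mod_cast hSg) (Finset.mem_coe.2 h))
  -- the count of the rank-`(v+1)` members against `T₁`: two targets each, two sources each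
  have hcount1 : D₁.card ≤ T₁.card := by
    have h := Finset.card_mul_le_card_mul (fun (S T : Finset α) => S ⊆ T) (s := D₁) (t := T₁) (m := 2) (n := 2) ?_ ?_
    · omega
    · intro S hS
      rw [hD₁, Finset.mem_filter] at hS
      obtain ⟨hSP, hSr⟩ := hS
      obtain ⟨hSg, hSc⟩ := hPmem S hSP
      have hout : 2 ≤ ((gr M).filter (fun x => x ∉ M.closure (S : Set α))).card := hout S hSg hSc hSr
      have himg : ((gr M).filter (fun x => x ∉ M.closure (S : Set α))).image (fun y => insert y S) ⊆
          Finset.bipartiteAbove (fun (S T : Finset α) => S ⊆ T) T₁ S := by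
        intro T hT
        rw [Finset.mem_image] at hT
        obtain ⟨y, hy, rfl⟩ := hT
        rw [Finset.mem_filter] at hy
        have hyS : y ∉ S := hnotMem S hSg y hy.2
        rw [Finset.mem_bipartiteAbove, hT₁, Finset.mem_filter]
        refine ⟨⟨hL2 S hSP hSr y hy.1 hy.2, Finset.insert_subset hy.1 hSg, ?_, ?_⟩, Finset.subset_insert y S⟩
        · rw [Finset.card_insert_of_notMem hyS, hSc]
        · rw [rkN_insert_of_notMem_closure hy.1 hy.2, hSr]
      have hinj : Set.InjOn (fun y => insert y S) (((gr M).filter (fun x => x ∉ M.closure (S : Set α))) : Set α) := by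
        intro y hy y' hy' hyy'
        rw [Finset.mem_coe, Finset.mem_filter] at hy hy'
        have hyS : y ∉ S := hnotMem S hSg y hy.2
        simp only at hyy'
        have : y ∈ insert y' S := hyy' ▸ Finset.mem_insert_self y S
        rcases Finset.mem_insert.1 this with h | h
        · exact h
        · exact absurd h hyS
      calc 2 ≤ ((gr M).filter (fun x => x ∉ M.closure (S : Set α))).card := hout
        _ = (((gr M).filter (fun x => x ∉ M.closure (S : Set α))).image (fun y => insert y S)).card :=
            (Finset.card_image_of_injOn hinj).symm
        _ ≤ (Finset.bipartiteAbove (fun (S T : Finset α) => S ⊆ T) T₁ S).card := Finset.card_le_card himg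
    · intro T hT
      rw [hT₁, Finset.mem_filter] at hT
      obtain ⟨_, hTg, hTc, hTr⟩ := hT
      have hsub : Finset.bipartiteBelow (fun (S T : Finset α) => S ⊆ T) D₁ T ⊆
          (T.powersetCard (v + 2)).filter (fun S => rkN M S = v + 1) := by
        intro S hS
        rw [Finset.mem_bipartiteBelow, hD₁, Finset.mem_filter] at hS
        obtain ⟨⟨hSP, hSr⟩, hST⟩ := hS
        rw [Finset.mem_filter, Finset.mem_powersetCard]
        exact ⟨⟨hST, (hPmem S hSP).2⟩, hSr⟩
      exact (Finset.card_le_card hsub).trans (card_filter_rkN_le_two hg hTg hTc hTr)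
  -- the count of the rank-`v` members against `T₂`: one target each, one source each
  have hcount2 : D₂.card ≤ T₂.card := by
    have h := Finset.card_mul_le_card_mul (fun (S T : Finset α) => S ⊆ T) (s := D₂) (t := T₂) (m := 1) (n := 1) ?_ ?_
    · omega
    · intro S hS
      rw [hD₂, Finset.mem_filter] at hS
      obtain ⟨hSP, hSr⟩ := hS
      obtain ⟨hSg, hSc⟩ := hPmem S hSP
      obtain ⟨y, hyg, hyc⟩ := exists_notMem_closure_of_rkN_eq hSr (le_trans (by exact_mod_cast (by omega : v + 1 ≤ v + 2)) hrank)
      have hyS : y ∉ S := hnotMem S hSg y hyc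
      have hSy : rkN M (insert y S) = v + 1 := by rw [rkN_insert_of_notMem_closure hyg hyc, hSr]
      obtain ⟨y', hy'g, hy'c⟩ := exists_notMem_closure_of_rkN_eq hSy hrank
      have hy'S : y' ∉ insert y S := hnotMem (insert y S) (Finset.insert_subset hyg hSg) y' hy'c
      refine Finset.card_pos.2 ⟨insert y' (insert y S), ?_⟩
      rw [Finset.mem_bipartiteAbove, hT₂, Finset.mem_filter]
      refine ⟨⟨hL3 S hSP hSr y hyg hyc y' hy'g hy'c, Finset.insert_subset hy'g (Finset.insert_subset hyg hSg), ?_, ?_⟩,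
        (Finset.subset_insert y S).trans (Finset.subset_insert y' _)⟩
      · rw [Finset.card_insert_of_notMem hy'S, Finset.card_insert_of_notMem hyS, hSc]
      · rw [rkN_insert_of_notMem_closure hy'g hy'c, hSy]
    · intro T hT
      rw [hT₂, Finset.mem_filter] at hT
      obtain ⟨_, hTg, hTc, hTr⟩ := hT
      have hsub : Finset.bipartiteBelow (fun (S T : Finset α) => S ⊆ T) D₂ T ⊆
          (T.powersetCard (v + 2)).filter (fun S => rkN M S = v) := by
        intro S hS
        rw [Finset.mem_bipartiteBelow, hD₂, Finset.mem_filter] at hS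
        obtain ⟨⟨hSP, hSr⟩, hST⟩ := hS
        rw [Finset.mem_filter, Finset.mem_powersetCard]
        exact ⟨⟨hST, (hPmem S hSP).2⟩, hSr⟩
      exact (Finset.card_le_card hsub).trans (card_filter_rkN_le_one hg hTg hTc hTr)
  -- the three target classes are disjoint subsets of `L`
  have hI_sub : I ⊆ L := by
    intro S hS
    rw [hI, Finset.mem_filter] at hS
    exact hL1 S hS.1 hS.2
  have hT₁_sub : T₁ ⊆ L := Finset.filter_subset _ _
  have hT₂_sub : T₂ ⊆ L := Finset.filter_subset _ _
  have hd1 : Disjoint I T₁ := by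
    rw [Finset.disjoint_left]
    intro S hSI hST
    rw [hT₁, Finset.mem_filter] at hST
    rw [hI, Finset.mem_filter] at hSI
    have := (hPmem S hSI.1).2
    omega
  have hd2 : Disjoint (I ∪ T₁) T₂ := by
    rw [Finset.disjoint_left]
    intro S hSU hST
    rw [hT₂, Finset.mem_filter] at hST
    rcases Finset.mem_union.1 hSU with hSI | hST₁
    · rw [hI, Finset.mem_filter] at hSI
      have := (hPmem S hSI.1).2
      omega
    · rw [hT₁, Finset.mem_filter] at hST₁
      omega
  calc P.card = I.card + D₁.card + D₂.card := hcover
    _ ≤ I.card + T₁.card + T₂.card := by omega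
    _ = (I ∪ T₁ ∪ T₂).card := by
        rw [Finset.card_union_of_disjoint hd2, Finset.card_union_of_disjoint hd1]
    _ ≤ L.card := Finset.card_le_card (Finset.union_subset (Finset.union_subset hI_sub hT₁_sub) hT₂_sub)

/-- Part B's `card_upAt_le_card_shadowLevel_pred` with `hout` in place of `ρ(E) ≥ v + 3`. -/
theorem card_upAt_le_card_shadowLevel_pred_out {v : ℕ} (hg : ∀ T ⊆ M.E, T.encard ≤ v → M.Indep T)
    (hrank : ((v + 2 : ℕ) : ℕ∞) ≤ M.eRank)
    (hout : ∀ S ⊆ gr M, S.card = v + 2 → rkN M S = v + 1 →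
      2 ≤ ((gr M).filter (fun x => x ∉ M.closure (S : Set α))).card)
    (𝒜 : Finset (Finset α)) :
    (Boolean.upAt (gr M) (v + 2) 𝒜).card ≤ (Shadow.shadowLevel M (v + 2) 𝒜).card := by
  apply card_le_card_of_girth_pred_family_out hg hrank hout
  · intro S hS
    rw [Boolean.mem_upAt] at hS
    exact Finset.mem_powersetCard.2 hS.1
  · intro S hS hSi
    rw [Boolean.mem_upAt] at hS
    rw [mem_shadowLevel, Profile.mem_levelSet]
    refine ⟨⟨hS.1.1, ?_⟩, hS.2⟩
    rw [hSi.eRk_eq_encard, Set.encard_coe_eq_coe_finsetCard, hS.1.2]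
  · intro S hS hSr y hyg hyc
    rw [Boolean.mem_upAt] at hS
    obtain ⟨B, hB, hBS⟩ := hS.2
    rw [mem_shadowLevel, Profile.mem_levelSet]
    refine ⟨⟨Finset.insert_subset hyg hS.1.1, ?_⟩, B, hB, hBS.trans (Finset.subset_insert y S)⟩
    rw [← Staged.coe_rkN, rkN_insert_of_notMem_closure hyg hyc, hSr]
  · intro S hS hSr y hyg hyc y' hy'g hy'c
    rw [Boolean.mem_upAt] at hS
    obtain ⟨B, hB, hBS⟩ := hS.2
    rw [mem_shadowLevel, Profile.mem_levelSet]
    refine ⟨⟨Finset.insert_subset hy'g (Finset.insert_subset hyg hS.1.1), ?_⟩, B, hB,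
      hBS.trans ((Finset.subset_insert y S).trans (Finset.subset_insert y' _))⟩
    rw [← Staged.coe_rkN, rkN_insert_of_notMem_closure hy'g hy'c, rkN_insert_of_notMem_closure hyg hyc, hSr]

/-- Part B's `hallIneq_of_girth_pred_rank` with `hout` in place of `ρ(E) ≥ v + 3`: the Hall form `(H⁺_{q, v+2})`
at girth `≥ v + 1`, `q + 1 ≤ v`, on matroids of rank `≥ v + 2` in which every `(v+2)`-set of rank `v + 1` has two
points outside its closure. -/
theorem hallIneq_of_girth_pred_out {q v : ℕ} (hg : ∀ T ⊆ M.E, T.encard ≤ v → M.Indep T)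
    (hrank : ((v + 2 : ℕ) : ℕ∞) ≤ M.eRank)
    (hout : ∀ S ⊆ gr M, S.card = v + 2 → rkN M S = v + 1 →
      2 ≤ ((gr M).filter (fun x => x ∉ M.closure (S : Set α))).card)
    (hqv : q + 1 ≤ v) : Profile.HallIneq M q (v + 2) := by
  intro 𝒜 h𝒜
  set n := (gr M).card with hn
  have hAq : 𝒜 ⊆ (gr M).powersetCard q := h𝒜.trans (Rq_subset_powersetCard hg (by omega))
  obtain ⟨k, hk⟩ : ∃ k, v + 2 = q + k := ⟨v + 2 - q, by omega⟩
  have hnmp := Boolean.card_mul_choose_le_card_upAt_mul_choose hAq k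
  rw [← hk] at hnmp
  by_cases hAe : 𝒜 = ∅
  · subst hAe
    simp only [Finset.sum_empty]
    exact Nat.cast_nonneg _
  · obtain ⟨B₀, hB₀⟩ := Finset.nonempty_iff_ne_empty.2 hAe
    have hqn : q ≤ n := by
      have h := Finset.mem_powersetCard.1 (hAq hB₀)
      rw [← h.2]; exact Finset.card_le_card h.1
    have hq : (0 : ℚ) < Nat.choose n q := by exact_mod_cast Nat.choose_pos hqn
    calc ∑ B ∈ 𝒜, Profile.price M q (v + 2) B
        ≤ ∑ _B ∈ 𝒜, (Nat.choose n (v + 2) : ℚ) / (Nat.choose n q : ℚ) := by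
          apply Finset.sum_le_sum
          intro B hB
          have hB' := Finset.mem_powersetCard.1 (hAq hB)
          exact price_le_of_card (by omega) hB'.1 hB'.2
      _ = (𝒜.card : ℚ) * ((Nat.choose n (v + 2) : ℚ) / (Nat.choose n q : ℚ)) := by
          rw [Finset.sum_const, nsmul_eq_mul]
      _ ≤ ((Boolean.upAt (gr M) (v + 2) 𝒜).card : ℚ) := by
          rw [← mul_div_assoc, div_le_iff₀ hq]
          exact_mod_cast hnmp
      _ ≤ ((Shadow.shadowLevel M (v + 2) 𝒜).card : ℚ) := by
          exact_mod_cast card_upAt_le_card_shadowLevel_pred_out hg hrank hout 𝒜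


/-- Erasing a point lowers the rank by at most one. -/
theorem rkN_le_rkN_erase_add_one {T : Finset α} (y : α) : rkN M T ≤ rkN M (T.erase y) + 1 := by
  have h := rkN_le_rkN_add_card_sdiff (M := M) (Finset.erase_subset y T)
  have hc : (T \ T.erase y).card ≤ 1 := by
    have : T \ T.erase y ⊆ {y} := by
      intro x hx
      rw [Finset.mem_sdiff, Finset.mem_erase] at hx
      rw [Finset.mem_singleton]
      by_contra hxy
      exact hx.2 ⟨hxy, hx.1⟩
    exact (Finset.card_le_card this).trans (by simp)
  omega

/-- **No coloop gives two points outside every hyperplane**: at rank `v + 2`, if erasing any point keeps the rank, then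
every `(v+2)`-subset of the ground set of rank `v + 1` has at least two points outside its closure. -/
theorem two_le_card_out_of_no_coloop {v : ℕ} (hE : M.eRank = ((v + 2 : ℕ) : ℕ∞))
    (hnc : ∀ y ∈ gr M, rkN M ((gr M).erase y) = v + 2) {S : Finset α}
    (hSr : rkN M S = v + 1) : 2 ≤ ((gr M).filter (fun x => x ∉ M.closure (S : Set α))).card := by
  obtain ⟨y, hyg, hyc⟩ := exists_notMem_closure_of_rkN_eq hSr (by rw [hE])
  have hyO : y ∈ (gr M).filter (fun x => x ∉ M.closure (S : Set α)) := Finset.mem_filter.2 ⟨hyg, hyc⟩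
  by_contra hcon
  have h1 : ((gr M).filter (fun x => x ∉ M.closure (S : Set α))).card = 1 := by
    have : 0 < ((gr M).filter (fun x => x ∉ M.closure (S : Set α))).card := Finset.card_pos.2 ⟨y, hyO⟩
    omega
  obtain ⟨z, hz⟩ := Finset.card_eq_one.1 h1
  have hyz : y = z := by
    have := hyO; rw [hz, Finset.mem_singleton] at this; exact this
  subst hyz
  -- every other point of the ground set lies in `cl S`
  have hsub : (((gr M).erase y : Finset α) : Set α) ⊆ M.closure (S : Set α) := by
    intro x hx
    rw [Finset.mem_coe, Finset.mem_erase] at hx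
    by_contra hxc
    have : x ∈ (gr M).filter (fun x => x ∉ M.closure (S : Set α)) := Finset.mem_filter.2 ⟨hx.2, hxc⟩
    rw [hz, Finset.mem_singleton] at this
    exact hx.1 this
  have h2 : rkN M ((gr M).erase y) ≤ v + 1 := by
    have h3 : M.eRk (((gr M).erase y : Finset α) : Set α) ≤ M.eRk (S : Set α) := by
      calc M.eRk (((gr M).erase y : Finset α) : Set α) ≤ M.eRk (M.closure (S : Set α)) := M.eRk_mono hsub
        _ = M.eRk (S : Set α) := M.eRk_closure_eq _
    rw [← Staged.coe_rkN, ← Staged.coe_rkN, hSr] at h3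
    exact_mod_cast h3
  have := hnc y hyg
  omega

omit [DecidableEq α] in
/-- Points of the ground set outside the closure of a set of rank `v` inside a subset `E'` of rank `v + 1`. -/
theorem exists_mem_notMem_closure_of_rkN_lt {E' S : Finset α} (hlt : rkN M S < rkN M E') :
    ∃ y ∈ E', y ∉ M.closure (S : Set α) := by
  by_contra hcon
  have hsub : (E' : Set α) ⊆ M.closure (S : Set α) := by
    intro x hx
    by_contra hxc
    exact hcon ⟨x, Finset.mem_coe.1 hx, hxc⟩
  have h : M.eRk (E' : Set α) ≤ M.eRk (S : Set α) := by
    calc M.eRk (E' : Set α) ≤ M.eRk (M.closure (S : Set α)) := M.eRk_mono hsub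
      _ = M.eRk (S : Set α) := M.eRk_closure_eq _
  rw [← Staged.coe_rkN, ← Staged.coe_rkN] at h
  have : rkN M E' ≤ rkN M S := by exact_mod_cast h
  omega

/-- `C(n, q) ≤ C(n, k)` for `q ≤ k` and `k + q ≤ n` (the binomial coefficients increase up to the middle, and
`C(n, k) = C(n, n − k)`). -/
theorem choose_le_choose_of_le_of_add_le {n q k : ℕ} (hqk : q ≤ k) (hkn : k + q ≤ n) :
    n.choose q ≤ n.choose k := by
  have chain : ∀ d r m : ℕ, 2 * m ≤ n → r + d ≤ m → n.choose r ≤ n.choose (r + d) := by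
    intro d
    induction d with
    | zero => intro r m _ _; simp
    | succ d ih =>
      intro r m hm hrd
      have h1 : n.choose r ≤ n.choose (r + 1) := Nat.choose_le_succ_of_lt_half_left (by omega)
      have h2 : n.choose (r + 1) ≤ n.choose (r + 1 + d) := ih (r + 1) m hm (by omega)
      rw [show r + (d + 1) = r + 1 + d by omega]
      exact h1.trans h2
  rcases Nat.lt_or_ge n (2 * k) with hlt | hge
  · -- `k` is past the middle: use the symmetry `C(n, k) = C(n, n − k)`
    have hsym : n.choose k = n.choose (n - k) := (Nat.choose_symm (by omega)).symm
    rw [hsym]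
    have := chain (n - k - q) q (n - k) (by omega) (by omega)
    rwa [show q + (n - k - q) = n - k by omega] at this
  · have := chain (k - q) q k hge (by omega)
    rwa [show q + (k - q) = k by omega] at this


end GirthRows

end PercRepro
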